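import Summits.BirchSwinnertonDyer.BirchSwinnertonDyer.Theorems.ByReductionTypeAtTwoRankOneAtTwoOffBigImageOddLocalArchCorestriction
import Literature.NumberTheory.EllipticCurves.SelmerPInftyRestriction
import Literature.NumberTheory.EllipticCurves.SelmerGaloisAction
import Literature.NumberTheory.EllipticCurves.HeegnerPoints
import Literature.NumberTheory.GaloisRepresentations.TateH2VanishingArchimedean
import Literature.NumberTheory.GaloisRepresentations.AbsGaloisGroup
import Mathlib.NumberTheory.NumberField.InfinitePlace.TotallyRealComplex
import Mathlib.FieldTheory.Galois.Infinite
import HarnessLib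

/-!
# Route `ByReductionTypeAtTwo`, crux `RankOneAtTwoOffBigImageOddLocal` (stmt-BirchSwinnertonDyer-23716), line
# `refined_kolyvagin_tamagawa_shift_at_two`, stub `stub_sigmaShiftPosDisc`: CORESTRICTED CLASSES FROM AN IMAGINARY
# QUADRATIC FIELD SATISFY EVERY LOCAL CONDITION AT THE REAL PLACE OF `ℚ` (the number-field half, PROVED)

Helper (lead `prover-cruxlead-stmt-BirchSwinnertonDyer-23716-g5`; `--supports` the crux, closes nothing).  Sequel to
`…OffBigImageOddLocalArchCorestriction` (p670249: a corestricted class dies on `{1, τ}` for an involution `τ` outside the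
index-`2` subgroup — generic continuous cohomology).  Here the number-field plumbing that was «left for the sequel»:

* §1 `eq_one_of_resGal_mem_galRange` — **a real place of `ℚ` does not split in an imaginary quadratic field, at the
  level of absolute Galois groups with the tree's chosen embeddings**: for `K` imaginary quadratic
  (`IsImaginaryQuadratic K`), `w` the infinite place of `ℚ` and `σ ∈ Γ_{ℚ_w}`, if `resGal σ ∈ Γ_ℚ` lies in the image
  `galRange K` of `Γ_K` then `σ = 1`.  (Else `Γ_{ℚ_w} = {1, σ}` — order `≤ 2`, tree
  `natCard_absoluteGaloisGroup_completion_infinitePlace_le_two` — fixes the copy `closureEmb (embIntoClosure K)` of `K`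
  inside `\overline{ℚ_w}`, which then lies in `ℚ_w` (`InfiniteGalois.mem_range_algebraMap_iff_fixed`), giving a ring map
  `K → ℚ_w ≅ ℝ ⊂ ℂ`, a REAL complex embedding of a totally complex field — contradiction.)  Abstract form
  `eq_one_of_resGal_mem_galRange_aux` for any `ℚ`-field `E` with `#Γ_E ≤ 2` and a ring map `E → ℝ`.
* §2 THE ARCHIMEDEAN CRITERION IN THE TREE'S SELMER CURRENCY: with `N = galRange K ≤ Γ_ℚ` (open, normal, index `2`,
  coset representative `c = liftToAbsGal K σ₀`, `σ₀ ≠ 1`, tree `xor_galRange`) and `cor = corH1` the index-`2` transfer: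
  `corH1_mem_resKer_resGal_infinitePlace` — for EVERY discrete `Γ_ℚ`-module `M` and every compatible pair
  `(resGal ℚ_w, ψ)`, `cor(y) ∈ resKer (resGal ℚ_w) ψ` for all `y ∈ H¹(N, M)`; whence, by unfolding the tree's
  definitions, `cor(y) ∈ W.localRestrictionKer ℚ_w` (`M = E(ℚ̄)`), `cor(y) ∈ W.torsionLocalKer ℚ_w n` and
  `cor(y) ∈ selmerLocalKer W ℚ_w n` (`M = E[n]`) — McCallum's Lemma 4.3 AT THE REAL PLACE holds for every class of
  `E` over `ℚ` that is a corestriction from `K`, on EITHER sign of `Δ(E)` (inputs `loc_c₁_inf` / `loc_c₂_inf` of the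
  sibling's `…VisiblePairAtTwoDefs.Input`, which the tree so far discharges only on `Δ < 0`).

With p670249's norm criterion (`mem_range_corH1_iff_exists_norm`: for `res` injective — `E(K)[2] = 0`, the habitat —
`x ∈ im(cor) ↔ res x` is a norm `y + τ_* y`) this types the located archimedean non-port of the lead's stub exactly:
the `ℚ`-descended Kolyvagin class `d(n)` satisfies the real condition as soon as `c(n) ∈ (1 + τ_*) H¹(K, E[2^M])`.
Everything here is PROVED (no `sorry`, no definition, no named fact, standard axioms).  BSD is not proved by any of
this; the stub is not proved by this.

References: [SerreGaloisCohomology1997] I §2.4, II §1.1 (decomposition groups at infinity); [NeukirchSchmidtWingberg2008]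
I §5 Prop. 1.5.6 (double cosets); [McCallumLMS1991] §4 Lemma 4.3; [GrossLMS1991] §6 proof of Prop. 6.2 (1);
[MilneADT2006] I Rem. 3.7.
-/

set_option autoImplicit false
set_option linter.dupNamespace false -- tree convention: `Summit.BirchSwinnertonDyer.BirchSwinnertonDyer.Theorems` (summit = sub-problem)

noncomputable section

namespace Summit.BirchSwinnertonDyer.BirchSwinnertonDyer.Theorems.OffBigImageOddLocalAtTwo.ArchCorestriction

open Literature.NumberTheory.EllipticCurves Literature.NumberTheory.GaloisRepresentations
open NumberField Field WeierstrassCurve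

/-! ## §1 A real place of `ℚ` does not split in an imaginary quadratic field -/

/-- For a `ℚ`-field `E` and `σ ∈ Γ_E`: the chosen embedding `ι : ℚ̄ → Ē` intertwines `resGal E σ` and `σ`
(pointwise, `•`-form; the tree's `apply_resGalAuxOfEmb_apply`). [cite: SerreGaloisCohomology1997, II §1.1] -/
theorem closureEmb_smul_resGal (E : Type) [Field E] [Algebra ℚ E] (σ : absoluteGaloisGroup E)
    (x : AlgebraicClosure ℚ) :
    closureEmb (K := ℚ) E (resGal (K := ℚ) E σ • x) = σ • closureEmb (K := ℚ) E x :=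
  apply_resGalAuxOfEmb_apply (closureEmb (K := ℚ) E) σ x

/-- **Abstract form**: for `K` imaginary quadratic, a `ℚ`-field `E` with `#Γ_E ≤ 2` admitting a ring map `E → ℝ`, and
`σ ∈ Γ_E`: if `resGal σ ∈ galRange K` then `σ = 1`.  (Else `Γ_E = {1, σ}` fixes the copy of `K` in `Ē`, which then lies in
`E` by infinite Galois theory, and `K → E → ℝ ⊂ ℂ` is a real complex embedding of a totally complex field.)
[cite: SerreGaloisCohomology1997, II §1.1] -/
theorem eq_one_of_resGal_mem_galRange_aux {K : Type} [Field K] [NumberField K] (hK : IsImaginaryQuadratic K)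
    {E : Type} [Field E] [Algebra ℚ E] [Finite (absoluteGaloisGroup E)]
    (h2 : Nat.card (absoluteGaloisGroup E) ≤ 2) (r : E →+* ℝ) (σ : absoluteGaloisGroup E)
    (hσ : resGal (K := ℚ) E σ ∈ galRange (K := ℚ) K) : σ = 1 := by
  by_contra hσ1
  haveI : CharZero E := charZero_of_injective_algebraMap (algebraMap ℚ E).injective
  -- the image of `K` in `Ē` is fixed by all of `Γ_E = {1, σ}`
  have hfix : ∀ (k : K) (f : absoluteGaloisGroup E),
      f • closureEmb (K := ℚ) E (embIntoClosure (K := ℚ) K k) = closureEmb (K := ℚ) E (embIntoClosure (K := ℚ) K k) := by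
    intro k f
    by_cases hf : f = 1
    · rw [hf, one_smul]
    · rw [eq_of_ne_one_of_natCard_le_two h2 hf hσ1]
      have h1 := closureEmb_smul_resGal E σ (embIntoClosure (K := ℚ) K k)
      have h3 : resGal (K := ℚ) E σ • embIntoClosure (K := ℚ) K k = embIntoClosure (K := ℚ) K k := by
        rw [absoluteGaloisGroup.smul_def]
        exact smul_embIntoClosure_of_mem_galRange K hσ k
      rw [h3] at h1
      exact h1.symm
  have hrange : ∀ k : K, ∃ x : E,
      algebraMap E (AlgebraicClosure E) x = closureEmb (K := ℚ) E (embIntoClosure (K := ℚ) K k) := fun k ↦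
    (InfiniteGalois.mem_range_algebraMap_iff_fixed (k := E) (K := AlgebraicClosure E) _).mpr fun f ↦ hfix k f
  -- hence a ring homomorphism `K → E → ℝ ⊂ ℂ`, a REAL complex embedding of `K`
  choose e he using hrange
  have hinj := (algebraMap E (AlgebraicClosure E)).injective
  let ψ : K →+* E :=
    { toFun := e
      map_one' := hinj (by rw [he, map_one, map_one, map_one])
      map_mul' := fun a b ↦ hinj (by rw [he, map_mul, map_mul, map_mul, he, he])
      map_zero' := hinj (by rw [he, map_zero, map_zero, map_zero])
      map_add' := fun a b ↦ hinj (by rw [he, map_add, map_add, map_add, he, he]) }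
  have hφ : ComplexEmbedding.IsReal (Complex.ofRealHom.comp (r.comp ψ)) := by
    rw [ComplexEmbedding.isReal_iff]
    ext1 k
    rw [ComplexEmbedding.conjugate_coe_eq, RingHom.comp_apply, Complex.ofRealHom_eq_coe, Complex.conj_ofReal]
  haveI : IsTotallyComplex K := hK.2
  exact IsTotallyComplex.complexEmbedding_not_isReal _ hφ

/-- **A real place of `ℚ` does not split in an imaginary quadratic field (absolute Galois groups).**  For `K`
imaginary quadratic, `w` the infinite place of `ℚ` and `σ ∈ Γ_{ℚ_w}`: if `resGal σ ∈ Γ_ℚ` lies in the image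
`galRange K` of `Γ_K`, then `σ = 1`.  (Otherwise `Γ_{ℚ_w} = {1, σ}` fixes the copy of `K` inside `\overline{ℚ_w}`,
so `K ↪ ℚ_w ≅ ℝ`, contradicting total complexity; `ℚ_w ≅ ℝ` by `InfinitePlace.Completion.ringEquivRealOfIsReal`, every
infinite place of `ℚ` being real.) [cite: SerreGaloisCohomology1997, II §1.1] -/
theorem eq_one_of_resGal_mem_galRange {K : Type} [Field K] [NumberField K] (hK : IsImaginaryQuadratic K)
    (w : InfinitePlace ℚ) (σ : absoluteGaloisGroup w.Completion)
    (hσ : resGal (K := ℚ) w.Completion σ ∈ galRange (K := ℚ) K) : σ = 1 :=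
  haveI := finite_absoluteGaloisGroup_completion_infinitePlace w
  eq_one_of_resGal_mem_galRange_aux hK (natCard_absoluteGaloisGroup_completion_infinitePlace_le_two w)
    (InfinitePlace.Completion.ringEquivRealOfIsReal (IsTotallyReal.isReal w)).toRingHom σ hσ


/-! ## §2 Corestricted classes satisfy every local condition at the real place -/

section RealPlace

variable {K : Type} [Field K] [NumberField K] [IsGalois ℚ K] [(galRange (K := ℚ) K).Normal]
variable {M : Type} [AddCommGroup M] [DistribMulAction (absoluteGaloisGroup ℚ) M] [TopologicalSpace M]
  [DiscreteTopology M]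

/-- **The archimedean criterion in the tree's currency (generic coefficients).**  `K` imaginary quadratic, `N = galRange K`
(coset representative `c = liftToAbsGal K σ₀`, `σ₀ ≠ 1`), `M` a discrete `Γ_ℚ`-module with continuous orbit maps, `w` the
infinite place of `ℚ`: for every compatible pair `(resGal ℚ_w, ψ)` and every `y ∈ H¹(N, M)`, the corestriction
`cor(y) ∈ H¹(ℚ, M)` lies in `resKer (resGal ℚ_w) ψ` — it dies at the real place.  (p670249's
`corH1_mem_resKer_of_natCard_le_two` with §1.) [cite: SerreGaloisCohomology1997, I §2.4] [cite: NeukirchSchmidtWingberg2008, I §5 Prop. 1.5.6] -/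
theorem corH1_mem_resKer_resGal_infinitePlace (hK : IsImaginaryQuadratic K) {σ₀ : K ≃ₐ[ℚ] K} (hσ₀ : σ₀ ≠ 1)
    (hM : ∀ m : M, Continuous fun g : absoluteGaloisGroup ℚ ↦ g • m) (w : InfinitePlace ℚ)
    {M' : Type} [AddCommGroup M'] [DistribMulAction (absoluteGaloisGroup w.Completion) M'] [TopologicalSpace M']
    [DiscreteTopology M'] (ψ : M →+ M')
    (h : ∀ (x : absoluteGaloisGroup w.Completion) (m : M), ψ (resGal (K := ℚ) w.Completion x • m) = x • ψ m)
    (y : subgroupH1 (galRange (K := ℚ) K) M) :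
    corH1 (isOpen_galRange K) hM (xor_galRange K hK.1 hσ₀) y ∈ resKer (resGal (K := ℚ) w.Completion) ψ h :=
  haveI := finite_absoluteGaloisGroup_completion_infinitePlace w
  corH1_mem_resKer_of_natCard_le_two (natCard_absoluteGaloisGroup_completion_infinitePlace_le_two w)
    (isOpen_galRange K) hM (xor_galRange K hK.1 hσ₀) (resGal (K := ℚ) w.Completion) ψ h
    (fun x hx ↦ by rw [eq_one_of_resGal_mem_galRange hK w x hx, map_one]) y

end RealPlace

section Selmer

variable {K : Type} [Field K] [NumberField K] [IsGalois ℚ K] [(galRange (K := ℚ) K).Normal]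
variable (W : WeierstrassCurve ℚ)

/-- **`H¹(ℚ, E)`-form**: a class of `H¹(ℚ, E)` corestricted from `H¹(K, E)` (`K` imaginary quadratic, subgroup model
`H¹(galRange K, E(ℚ̄))`) lies in `W.localRestrictionKer ℚ_w` — it vanishes in `H¹(ℚ_w, E)`, `w` the real place, for EVERY
`E/ℚ` (no sign condition on `Δ`). [cite: GrossLMS1991, §6 (proof of Prop. 6.2 (1))] [cite: SerreGaloisCohomology1997, I §2.4] -/
theorem corH1_mem_localRestrictionKer_infinitePlace (hK : IsImaginaryQuadratic K) {σ₀ : K ≃ₐ[ℚ] K} (hσ₀ : σ₀ ≠ 1)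
    (w : InfinitePlace ℚ) (y : subgroupH1 (galRange (K := ℚ) K) (geomPoints W)) :
    corH1 (isOpen_galRange K) (continuous_smul_geomPoints W) (xor_galRange K hK.1 hσ₀) y ∈
      W.localRestrictionKer w.Completion :=
  corH1_mem_resKer_resGal_infinitePlace hK hσ₀ (continuous_smul_geomPoints W) w _ _ y

/-- **`H¹(ℚ, E[n])`-form, strict condition**: a class of `H¹(ℚ, E[n])` corestricted from `H¹(galRange K, E[n])` lies in
`W.torsionLocalKer ℚ_w n` — it vanishes in `H¹(ℚ_w, E[n])` (not only in `H¹(ℚ_w, E)`), `w` the real place, any `E/ℚ`, any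
`n`.  `hM`: continuity of the `Γ_ℚ`-orbit maps of `E[n]` (discrete coefficients). [cite: McCallumLMS1991, §4 Lemma 4.3]
[cite: SerreGaloisCohomology1997, I §2.4] -/
theorem corH1_mem_torsionLocalKer_infinitePlace (hK : IsImaginaryQuadratic K) {σ₀ : K ≃ₐ[ℚ] K} (hσ₀ : σ₀ ≠ 1) (n : ℤ)
    (hM : ∀ m : geomTorsion W n, Continuous fun g : absoluteGaloisGroup ℚ ↦ g • m) (w : InfinitePlace ℚ)
    (y : subgroupH1 (galRange (K := ℚ) K) (geomTorsion W n)) :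
    corH1 (isOpen_galRange K) hM (xor_galRange K hK.1 hσ₀) y ∈ W.torsionLocalKer w.Completion n :=
  corH1_mem_resKer_resGal_infinitePlace hK hσ₀ hM w _ _ y

/-- **`H¹(ℚ, E[n])`-form, Selmer condition** (the shape of `loc_c₁_inf` / `loc_c₂_inf`): a class of `H¹(ℚ, E[n])`
corestricted from `H¹(galRange K, E[n])` lies in `selmerLocalKer W ℚ_w n`, `w` the real place, any `E/ℚ`, any `n`.
[cite: McCallumLMS1991, §4 Lemma 4.3] [cite: GrossLMS1991, §6 (proof of Prop. 6.2 (1))] -/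
theorem corH1_mem_selmerLocalKer_infinitePlace (hK : IsImaginaryQuadratic K) {σ₀ : K ≃ₐ[ℚ] K} (hσ₀ : σ₀ ≠ 1) (n : ℤ)
    (hM : ∀ m : geomTorsion W n, Continuous fun g : absoluteGaloisGroup ℚ ↦ g • m) (w : InfinitePlace ℚ)
    (y : subgroupH1 (galRange (K := ℚ) K) (geomTorsion W n)) :
    corH1 (isOpen_galRange K) hM (xor_galRange K hK.1 hσ₀) y ∈ selmerLocalKer W w.Completion n :=
  W.torsionLocalKer_le_selmerLocalKer w.Completion n (corH1_mem_torsionLocalKer_infinitePlace W hK hσ₀ n hM w y)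

end Selmer

end Summit.BirchSwinnertonDyer.BirchSwinnertonDyer.Theorems.OffBigImageOddLocalAtTwo.ArchCorestriction

end
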